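import Literature.MathematicalPhysics.QuantumFieldTheory.Balaban1983to89.B4LeafRegular
import Literature.MathematicalPhysics.QuantumFieldTheory.Balaban1983to89.B5ResidualGpTorusHolds
import Literature.MathematicalPhysics.QuantumFieldTheory.Balaban1983to89.B7ConclConcrete

/-!
# NODE 00 (YM-PLAN Track A) — NON-VACUITY OF THE STAGE-1∕2 FAMILIES OF RECORD: the index types of the pinned carrier
# groups (B4 `famE famU famF`, B5 `fam5`, B7 `one7 kexp7 gd7`) are INHABITED under the printed parameter constraints —
# and WHY `Node00Carriers.Stage1Params.Admissible` carries `0 ≤ m²₊` (pub-ymgap lead R302, located item e3)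

NODE 00 CELL FILE (seat `pub-ymgap-node00-def`, g4 2026-08-23, revised g5 2026-08-24; report NODE00-SCOPING.md §3 F3 ∕ §5 Q-N00-6 «VACUITY STANDARD for
‹of record›»; YM-PLAN §2a names the adversarial case «empty B5 index»).  Tree-only imports; single-file checkable; count-neutral;
NOT proposed (R296).  Kernel bookkeeping over the lineages' index structures; nothing of Bałaban's asserted.

WHY.  A family `fam : I → Setting` over an EMPTY index type `I` makes every «∀ i, …» leaf hold vacuously.  The Stage-1∕2 modules pin
`X`'s B4 group to `torusPairFam` (index `B4TorusPairFam.TorusPairInst (D−1) (L−1) a₋ a₊ m²₊`), `regularFieldRegionsW` (index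
`B4Prop23RegularWindow.RegularRegionIdxW (D−1) ι L′ a₋ a₊ m²₊`), `regularFormSetting` (index `B4Prop31Regular.RegularFormInstance (D−1)`),
the B5 group to `famG D L a` (index `B5ResidualGpTorusHolds.TopIdx D L`) and the B7 group to the r04 carriers (indices
`B7ConclOneStep.Idx D`, `ℕ`, `B7ConclKExp.KIdx D`, `B7ConclGauge.GIdx 𝔸 D L`, `PUnit`).  This file records, index by index, the
parameter constraints under which each is inhabited (§1–§3) and the one EMPTINESS fact that bites (§1 `isEmpty_torusPairInst_of_neg`,
`isEmpty_regularRegionIdxW_of_neg`): for `m²₊ < 0` BOTH [Balaban1983RegularityDecay] index types are empty.  LOCATED ITEM (e3), RULED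
(pub-ymgap lead R302, cross-reader countersign): the pre-ruling root `Node00Carriers.lean` d11d06c31453301d required `a₋ ≤ a₊`, `0 < a₋`, … but
NOT `0 ≤ m²₊`; the root OF RECORD carries `0 ≤ θ.m2plus` as the LAST conjunct of `Stage1Params.Admissible` (print: «m² ≥ 0», (1.6) p.572), so
EVERY admissible `θ` has all seven pinned index types inhabited — the θ-level corollary is `Node00NonVacuityTheta.nonempty_indices_of_admissible`
(a later module importing the root; the statements below are over the raw parameters exactly as the lineage structures take them, so this
file lands independently of the root).  Companion (hypothesis half at the [Balaban1985Averaging] carriers): `Node00NonVacuityB7`.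
HONEST FRAMING: inhabitedness of index types is the MINIMAL sanity half of the vacuity standard (the other half — every field read by a
conjunct is the printed object — is the per-field cross-read, report App. A–G); one finite T⁴ programme, NOT continuum ∕ infinite volume ∕
OS ∕ mass gap ∕ Clay.
-/

noncomputable section

namespace Literature.MathematicalPhysics.QuantumFieldTheory.Balaban1983to89.Node00

open B4TorusPairFam (TorusPairInst)
open B4Prop23RegularWindow (RegularRegionIdxW)
open B4Prop23RegularFamily (RegularRegionIdx)
open B4Prop31Regular (RegularFormInstance)
open B5ResidualGpTorusHolds (TopIdx)
open B7ConclOneStep (Idx)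
open B7ConclKExp (KIdx)
open B7ConclGauge (GIdx cB cB_pos)
open B7Prop2Explicit (pdev unitaryUnits)

/-! ## §1. The [Balaban1983RegularityDecay] indices (B4 group: Theorem p. 573, Prop. 2.3, Prop. 3.1′) -/

/-- **The torus region-pair index is inhabited** whenever the weight window is consistent (`a₋ ≤ a₊`) and the mass window is (`0 ≤ m²₊`):
witness = scale `k = 1`, the torus with `3` unit blocks per direction (fine period `3(ℓ+1) ≥ 3`), `Ω = Ω₀ = ∅`, `a = a₋`, `m² = 0`, zero field,
zero coupling.  (Every printed instance — any torus, any block unions `Ω ⊂ Ω₀`, any `a ∈ [a₋, a₊]`, `m² ∈ [0, m²₊]`, any field and coupling — is a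
term of the structure by its constructor; this lemma is only the sanity half of the vacuity standard.) [cite: Balaban1983RegularityDecay, p.572 (the tori T_η and regions Ω ⊂ Ω₀), (1.6) p.572 (m² ≥ 0, a), (1.14) p.573 (a_k) — dictionary ∕ bookkeeping] -/
theorem nonempty_torusPairInst (d ℓ : ℕ) {amin aplus m2plus : ℝ} (hap : amin ≤ aplus) (hm : 0 ≤ m2plus) :
    Nonempty (TorusPairInst d ℓ amin aplus m2plus) :=
  ⟨{ k := 1, hk := le_rfl, P := fun _ => 3, hP := fun _ => by norm_num,
     h3 := fun _ => by simp only [B4TorusRegionOp.per, pow_one]; exact Nat.le_mul_of_pos_left 3 (Nat.succ_pos ℓ),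
     Ω₀T := ∅, ΩT := ∅, hbox := Finset.empty_subset _, hsub := le_rfl,
     a := amin, m2 := 0, ha1 := le_rfl, ha2 := hap, hm1 := le_rfl, hm2 := hm, Ac := fun _ _ => 0, e := 0 }⟩

/-- **… and EMPTY when the mass window is inconsistent** (`m²₊ < 0`: the fields `0 ≤ m² ≤ m²₊` cannot be filled) — so at such parameters the
torus-pair family of record `torusPairFam` has NO member and conjunct 1 of the B4 leaf (Theorem p. 573) holds vacuously there.  This is the located
reason (item e3, ruling R302) why `Stage1Params.Admissible` carries `0 ≤ m²₊`. [cite: Balaban1983RegularityDecay, (1.6) p.572 («m² ≥ 0») — bookkeeping] -/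
theorem isEmpty_torusPairInst_of_neg (d ℓ : ℕ) {amin aplus m2plus : ℝ} (hm : m2plus < 0) :
    IsEmpty (TorusPairInst d ℓ amin aplus m2plus) :=
  ⟨fun i => absurd (i.hm1.trans i.hm2) (not_le.mpr hm)⟩

/-- **The regular-field nested-region index with window (Prop. 2.3 family) is inhabited** under the same two window conditions: witness =
`a_k = a₋`, mesh `n = 1`, `m² = 0`, empty label sets, `Λ = ∅`, zero field, zero charge. [cite: Balaban1983RegularityDecay, (1.6) p.572, (1.13)–(1.14) p.573, Prop. 2.3 of [1] (1.15)–(1.20) p.574 — dictionary ∕ bookkeeping] -/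
theorem nonempty_regularRegionIdxW (d : ℕ) (ι : Type) (L : ℕ) {amin aplus m2plus : ℝ} (hap : amin ≤ aplus)
    (hm : 0 ≤ m2plus) : Nonempty (RegularRegionIdxW d ι L amin aplus m2plus) :=
  ⟨{ ak := amin, hak := le_rfl, hak' := hap,
     idx := { n := 1, hn := le_rfl, m2 := 0, hm := le_rfl, hm' := hm, Zc := ∅, Z₀c := ∅, hsub := le_rfl, Λ := ∅,
              Ac := fun _ _ => 0, e := 0 } }⟩

/-- **… and EMPTY when `m²₊ < 0`** (the inner index `RegularRegionIdx` needs `0 ≤ m² ≤ m²₊`): the Prop.-2.3 family of record is then memberless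
too. [cite: Balaban1983RegularityDecay, (1.6) p.572 — bookkeeping] -/
theorem isEmpty_regularRegionIdxW_of_neg (d : ℕ) (ι : Type) (L : ℕ) {amin aplus m2plus : ℝ} (hm : m2plus < 0) :
    IsEmpty (RegularRegionIdxW d ι L amin aplus m2plus) :=
  ⟨fun i => absurd (i.idx.hm.trans i.idx.hm') (not_le.mpr hm)⟩

/-- **The regular-form index (Prop. 3.1′ family) is inhabited unconditionally** (mesh `1`, empty region, zero charge and field).
[cite: Balaban1983RegularityDecay, Prop. 3.1′ of [2] (1.21)–(1.22) p.574 — dictionary ∕ bookkeeping] -/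
theorem nonempty_regularFormInstance (d : ℕ) : Nonempty (RegularFormInstance d) :=
  ⟨{ n := 1, hn := le_rfl, Ωc := ∅, e := 0, Ac := fun _ _ => 0 }⟩

/-! ## §2. The [Balaban1984PropagatorsI] index (B5 group: the top-level tori) -/

/-- **B5's top-level torus index is inhabited** for every dimension `d ≥ 1` and block size `L` odd `> 1` (witness: `m = 0`, `K = 1`).
[cite: Balaban1984PropagatorsI, (1.1)–(1.6) pp.18–19 (the tori T^{(k)}) — dictionary ∕ bookkeeping] -/
theorem nonempty_topIdx {d L : ℕ} (hd : 1 ≤ d) (hL : Odd L ∧ 1 < L) : Nonempty (TopIdx d L) :=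
  ⟨{ P := { d := d, L := L, m := 0, K := 1, hd := hd, hL := hL }, hPd := rfl, hPL := rfl, hK := le_rfl }⟩

/-! ## §3. The [Balaban1985Averaging] indices (B7 group: the r04 carriers) -/

/-- **The one-step index is inhabited** in dimension `d ≥ 2` (a plaquette needs two distinct directions). [cite: Balaban1985Averaging, (51) p.26 (plaquettes p′ of the L-lattice) — dictionary ∕ bookkeeping] -/
theorem nonempty_idx {d : ℕ} (hd : 2 ≤ d) : Nonempty (Idx d) :=
  ⟨{ z := fun _ => 0, μ := ⟨0, by omega⟩, ν := ⟨1, by omega⟩, hμν := by simp [Fin.ext_iff], q := fun _ => 0,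
     κ := ⟨0, by omega⟩ }⟩

/-- **The k-fold index is inhabited** in dimension `d ≥ 1`. [cite: Balaban1985Averaging, (127) p.37 (bonds of Ω^{(k)}) — dictionary ∕ bookkeeping] -/
theorem nonempty_kIdx {d : ℕ} (hd : 1 ≤ d) : Nonempty (KIdx d) :=
  ⟨{ k := 0, z := fun _ => 0, κ := ⟨0, by omega⟩, y := fun _ => 0, μ := ⟨0, by omega⟩ }⟩

section Gauge

variable (𝔸 : Type) [CStarAlgebra 𝔸]

/-- **The gauge-transformation index is inhabited** for every `d` and block size `L ≥ 1`: the unit background `U₀ ≡ 1` is `U(𝔸)`-valued and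
satisfies (52) at `α₀ = c₂ = cB d L > 0` (`B7ConclGauge.cB_pos`; the unit configuration has plaquette deviation `0` — every transport of `1` is `1`,
`B8Ineq130.hol_one` — a fact inlined here because a top-level statement of it would duplicate the Summits-side
`T4Continuum.ShellMeasureLandauCorrectionB7Flat.pdev_one`, which a Literature module cannot import). [cite: Balaban1985Averaging, (52) p.26, (177) p.45 — dictionary ∕ bookkeeping] -/
theorem nonempty_gIdx (d : ℕ) {L : ℕ} (hL : 1 ≤ L) : Nonempty (GIdx 𝔸 d L) :=
  ⟨{ k := 0, U₀ := 1, hU₀ := fun _ _ => Subgroup.one_mem _,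
     h52 := by
       rw [show pdev (1 : B7Prop1Explicit.Site d → Fin d → 𝔸ˣ) = 0 by simp [pdev, B8Ineq130.hol_one]]
       simpa using cB_pos d hL }⟩

end Gauge

/-! ## §4. Summary at the Stage-1∕2 parameters (raw form; the θ-level corollary over `Stage1Params.Admissible` is `Node00NonVacuityTheta`'s) -/

/-- **All seven pinned index types are inhabited** at parameters with `D ≥ 2`, `L` odd `> 1` (so `L ≥ 3`, `L − 1 ≥ 1`), `a₋ ≤ a₊` AND `0 ≤ m²₊` —
the B4 indices at dimension `D − 1` and block `ℓ = L − 1` (as `carriers₁B4` instantiates them), B5's at `(D, L)`, B7's at `(D, L)` over any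
`𝔸`. [cite: Balaban1983RegularityDecay, p.572–574; Balaban1984PropagatorsI, pp.18–19; Balaban1985Averaging, p.26 — dictionary ∕ bookkeeping] -/
theorem nonempty_indices {D L : ℕ} (hD : 2 ≤ D) (hL : Odd L ∧ 1 < L) (ι : Type) {amin aplus m2plus : ℝ}
    (hap : amin ≤ aplus) (hm : 0 ≤ m2plus) (𝔸 : Type) [CStarAlgebra 𝔸] :
    Nonempty (TorusPairInst (D - 1) (L - 1) amin aplus m2plus) ∧
      Nonempty (RegularRegionIdxW (D - 1) ι (L - 1 + 1) amin aplus m2plus) ∧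
        Nonempty (RegularFormInstance (D - 1)) ∧ Nonempty (TopIdx D L) ∧
          Nonempty (Idx D) ∧ Nonempty (KIdx D) ∧ Nonempty (GIdx 𝔸 D L) :=
  ⟨nonempty_torusPairInst _ _ hap hm, nonempty_regularRegionIdxW _ _ _ hap hm, nonempty_regularFormInstance _,
    nonempty_topIdx (le_trans one_le_two hD) hL, nonempty_idx hD, nonempty_kIdx (le_trans one_le_two hD),
    nonempty_gIdx 𝔸 D (le_of_lt hL.2)⟩

end Literature.MathematicalPhysics.QuantumFieldTheory.Balaban1983to89.Node00

end
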